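import Mathlib
import Summits.NavierStokesRegularity.NavierStokesRegularity.Theorems.TaoLadderRungThreeLocalDynamicsSufficesAt
import Summits.NavierStokesRegularity.NavierStokesRegularity.Theses.BarrierStepRungThree
import HarnessLib

/-!
# `BarrierStepRungThree.LocalDynamicsSufficesAt` (item stmt-NavierStokesRegularity-23423, re-wanted verbatim)

The support `LocalDynamicsSufficesAt` of route `BarrierStepRungThree` is, character for character,
the shared support of routes `TaoLadderRungThree` / `TrappingWindowRungThree` / `ExactWindowRungThree`
(items stmt-NavierStokesRegularity-20426 / 21752), proved in the tree by
`Theorems.LocalDynamicsSufficesAt.noGlobalCascade_of_local` (file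
`TaoLadderRungThreeLocalDynamicsSufficesAt.lean`): `DynamicsLocalAt ε₀ R` yields an `R`-comparable
table with `NoGlobalCascade ε₀`. This file closes the new item by that theorem.

HONEST FRAMING: bookkeeping about Tao-type MODEL lattice ODEs; nothing about Navier–Stokes.
-/

noncomputable section

set_option linter.dupNamespace false

namespace Summit.NavierStokesRegularity.NavierStokesRegularity.Theorems

open LocalDynamicsSufficesAt in
/-- **Item stmt-NavierStokesRegularity-23423** (`BarrierStepRungThree.LocalDynamicsSufficesAt`): for
`ε₀ > 0` and `R ≥ 1`, `DynamicsLocalAt ε₀ R` gives `α ∈ InTableClass R` and `X₀` with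
`NoGlobalCascade ε₀ α X₀`, closed by the tree theorem
`LocalDynamicsSufficesAt.noGlobalCascade_of_local`. [cite: Tao2016AveragedNS, §6.2 p. 32 with §6.1 p. 31] -/
theorem barrierStepRungThree_localDynamicsSufficesAt_proof :
    Summit.NavierStokesRegularity.NavierStokesRegularity.Theses.BarrierStepRungThree.LocalDynamicsSufficesAt := by
  unfold
    Summit.NavierStokesRegularity.NavierStokesRegularity.Theses.BarrierStepRungThree.LocalDynamicsSufficesAt
  intro ε₀ R hε₀ _hR hdyn
  obtain ⟨θ, c, i₀, α, X₀, P, Q, _hθ0, hθ, hc, hα, hX₀, hP, hstep⟩ := hdyn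
  exact ⟨α, X₀, hα, noGlobalCascade_of_local (Q := Q) hε₀ hθ hc hX₀ hP hstep⟩

end Summit.NavierStokesRegularity.NavierStokesRegularity.Theorems

end
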